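import Summits.AtomisticToContinuum.Crystallization.Theorems.FrustratedLawDichotomyStrainedPatchEnvelopeTaylor

/-!
# Pairs are recuts: the level-1/level-2 record re-typed on RECUT PAIRS, `κA` eliminated, the chart family pinned interior (lens-5 g54 «RecutPairs»)

Crux 27623 (T-side `StrainedPatchRec`), residual-mode cell decomp-a2c, node [CORE-FAR] `CoreOffTubeFloor (63/10) (63/10) (24/5) (1/100) 0`.
This file is STEP 0 of the g54 order (critic rows 975 (b), 980 (c)): the FOOTPRINT of the refit (RF) and the (α)/(β) decision, typed; then the record
of g53 («EnvelopeLaw» §3–§4, «EnvelopeTaylor» §5) re-assembled on it with every seam proved and every g53 leaf that survives traded in by a one-line proof.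

## STEP 0 — the footprint of (RF)'s recut images (kinematics; numbers: `decomp-a2c-lens-5/g54/out/refit54.json`)

A chart instance `z₀` is PRESENTED by `(φ, b₀, G₀, ξ₀)`: branch `φ` (fcc/hcp), bend `b₀ ∈ 𝓑₀`, matrix `‖G₀ − 1‖ ≤ 1/4`, hcp offset `‖ξ₀‖ ≤ 1/4`
(`PresentedBy`, the body of `IsBentBall ∘ IsHomBall` with the witnesses exposed).  The refit of a charted cluster re-cuts `z₁ := (1+A)·z₀` to the `133/10`
ball, `A` = the least-squares linear part of the deviation field on the uncapped annulus `U`.  EXACTLY: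
* `G₁ = (1+A)·G₀`, `ξ₁ = ξ₀` (the hcp offset is a LATTICE coordinate: unchanged), `b₁ ∘ (1+A) = (1+A) ∘ b₀` (conjugate bend), SAME branch `φ`;
* `dev₁ = dev₀ − A·w⁰` on labelled sites (`dev_recut`), `= (1 − P)u` on `U` (`projectedFree`);
* `‖G₁ − G₀‖ ≤ (5/4)‖A‖` (`RecutNear.footprint`), and `‖A‖ ≤ κL·t` with the least-squares constant `κL = max_{|y|=1} Σ_{a∈U} |⟨Γ⁻¹y, w_a⟩|`,
  `Γ = Σ_U w⊗w`: MEASURED `κL ∈ [0.247, 0.316]` over twenty lattice annuli (fcc/hcp, `d ∈ [0.95, 1.10]`, strains ≤ 10 %; `|U| = 84…324`, a thin shell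
  `r ∈ [5.4…6.18, 6.3]`, `eig Γ/|U| ∈ [8.4, 17.7]`) — pinned `κL₀ = 2/5`;
* the sup-norm amplification of the pinned g53 fine clause, `κA = sup ‖(1−P)u‖_∞/t`, is BRACKETED `[2.45, 2.85]` on every geometry (flipped-site sign
  field realises the lower end): the g53 pin `κA₀ = 2` («EnvelopeLaw».kA0) is violated by the canonical recut everywhere.  ⇒ `κA` is ELIMINATED below: the
  comparison chart is only COARSE (`τ₁`), the fine data travel in the chart predicate `projectedFree … t` (which (LIN) consumed anyway; (BAS) now starts
  from it).

## The decision — (β) AS RULED (critic row 982 (b)), implemented as «pairs are recuts» with the footprint on the CHART side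

(β): F3/DOM/MEM on the recut-image subfamily `𝓘₁ʳ = {‖ξ‖ ≤ 1/10, singular values of G ∈ 1 ± 0.15…0.18}` with T2 inherited.  The footprint says
`ξ₁ = ξ₀` and `G₁ = (1+A)G₀`: the recut image's `(ξ, G, branch)` are its CHART's, so (i) (RFᴿ) cannot PROVE `‖ξ₁‖ ≤ 1/10` (nor the box / `Sep` slack)
kinematically — the typed chart family `bentFamily 𝓑₀ (1/16)` contains instances with `‖ξ₀‖ = 1/4`, `‖G₀ − 1‖ = 1/4`, a pair at distance exactly `7/10`;
the footprint therefore enters as a HYPOTHESIS ON THE CHART: `𝓘₀ᴿ := bentFamily 𝓑₀ (1/16) ∩ InteriorChart 𝓑₀ β₀ ς₀ s₀` (`‖G₀ − 1‖ ≤ 9/50`, `‖ξ₀‖ ≤ 1/10`,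
bent lattice `3/4`-separated on the `27/2`-window), carried by (F2ᴿ) = (F2-bent₀) + three columns (census FOOTPRINT27 already measured admissible chart centres at strain `≤ 0.132`,
`‖ξ‖ ≤ 0.053`, `d ≥ 0.877`: the columns are physically free; a certified ∀-footprint over the typed family is NOT recommended — false at the typed
boundary, see (i)); and (ii) the recut image is not an arbitrary member of `𝓘₁ʳ`: it is tied to ITS chart by `(φ, G₀, ξ₀, b₀, A)`, so the PAIR
RELATION is re-typed from `LevelNear` (level only — which let (F3-bent₁), (DOM-bent₁) range over cross-phase pairs and over the `(1/4,1/4)` hcp corner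
paired with honest hcp charts, pairs BUDGET52/53 never evaluated) to `LevelNear ∧ RecutNear 𝓑₀ κL t` (`RecutNear`: common branch, common `(G₀, ξ₀)` up to
`(1+A)`, `‖A‖ ≤ κL·t`, conjugate bends); the recut images of `𝓘₀ᴿ` then form exactly `𝓘₁ʳ` (`‖ξ‖ ≤ 1/10`, `‖G − 1‖ ≤ 9/50 + 1/120`).  Consequences:
* `𝓘₁⁺ = CompFamily1` is kept VERBATIM as the family (T2) quantifies over ⇒ (T2-bent₁) (`…TaylorClose.taylorTwoBent1_holds`, g53 J) is consumed
  VERBATIM, not even a monotonicity bridge (`envelopeRBent1_of_taylor`);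
* (F3ᴿ), (DOMᴿ), (MEMᴿ) quantify over (chart ∈ 𝓘₀ᴿ, recut) pairs: their census box is (FOOTPRINT27 chart box) × (‖A‖ ≤ κL₀T₀ ≤ 1/150), the tables `Φ₁`
  switch on the chart's FITTED phase consistently (fitted pattern = branch for admissible centres, FOOTPRINT27: 0/538); the g53 leaves imply them
  (`…_of_certBent1`, `…_of_dominationBent1`, `…_of_membershipBent1`);
* (RFᴿ) lands `(1+A)G₀` in the `1/4`-box and keeps `Sep (7/10)` from the INTERIOR slack of `𝓘₀ᴿ` (`0.07 ≫ 1/120`; `3/4·(1 − 1/150) ≥ 7/10` on the `27/2`-window,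
  which contains every label entering the re-cut `133/10`-ball since `133/10·150/149 < 27/2`);
* (BASᴿ), (LINᴿ) start from the coarse comparison chart + `projectedFree t` (no `κA`); (LIN)'s census cone-LP never used the sup clause.

## Contents (this file is FAMILY-PARAMETRIC: every statement takes the chart family `𝓘₀`, the comparison family `𝓘₁` and the bend set `𝓑₀` as arguments)
§1 presentations, `RecutNear`, footprint lemmas · §2 the paired level 2: (BASᴿ) (MEMᴿ) (LINᴿ) (ENVᴿ), seam with (T2) unpaired · §3 the paired level 1:
(RFᴿ) (DOMᴿ) (F1ᴿ-cap), seam; level 0: (F3ᴿ), seam to `EdgeFarFloor`/[CORE-FAR] (`coreOff_of_familyRecutCap_of_band_of_soft`) · §4 the footprint hypothesis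
`InteriorChart` and the pins `β₀ ς₀ s₀ κL₀`.  The PINNED families and the ten-binder record node live in `…StrainedPatchRecutRecord` (two pin sets: over the
g53 families `bentFamily 𝓑₀ (1/16)` / `𝓘₁⁺`, and over the window-honest families of `…StrainedPatchWindowFamilies` — see the RIM CRACK documented there);
the recut kinematics (inverse of `1+A`, conjugate bend, window separation) in `…StrainedPatchRecutKinematics`.  No sorry, no new axioms, no cite tokens,
no instances / notation.
-/

namespace Summit.AtomisticToContinuum.Crystallization.Theorems.FrustratedLawDichotomyStrainedPatchRecutPairs

open scoped BigOperators Classical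
open Summit.AtomisticToContinuum.Crystallization.Theorems.FrustratedLawDichotomyPeriodicBlockFlags (goodAtScale_mono)
open Summit.AtomisticToContinuum.Crystallization.Theorems.FrustratedLawDichotomyRangeCut (Sep)
open Summit.AtomisticToContinuum.Crystallization.Theorems.FrustratedLawDichotomyMotifLemmas
open Summit.AtomisticToContinuum.Crystallization.Theorems.FrustratedLawDichotomyAveragingCut
open Summit.AtomisticToContinuum.Crystallization.Theorems.FrustratedLawDichotomyAveragingRuleCap
open Summit.AtomisticToContinuum.Crystallization.Theorems.FrustratedLawDichotomyAveragingRuleTightFree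
open Summit.AtomisticToContinuum.Crystallization.Theorems.FrustratedLawDichotomyExemptDoor (SitePred)
open Summit.AtomisticToContinuum.Crystallization.Theorems.FrustratedLawDichotomyExemptAbsorption
open Summit.AtomisticToContinuum.Crystallization.Theorems.FrustratedLawDichotomyExemptAbsorptionRecord
open Summit.AtomisticToContinuum.Crystallization.Theorems.FrustratedLawDichotomyCollarCensus
open Summit.AtomisticToContinuum.Crystallization.Theorems.FrustratedLawDichotomyCollarCensusKappa
open Summit.AtomisticToContinuum.Crystallization.Theorems.FrustratedLawDichotomyStrainedPatchHomSplit
open Summit.AtomisticToContinuum.Crystallization.Theorems.FrustratedLawDichotomyStrainedPatchCleanCollar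
open Summit.AtomisticToContinuum.Crystallization.Theorems.FrustratedLawDichotomyStrainedPatchHomTube
open Summit.AtomisticToContinuum.Crystallization.Theorems.FrustratedLawDichotomyStrainedPatchHomIsometry
open Summit.AtomisticToContinuum.Crystallization.Theorems.FrustratedLawDichotomyStrainedPatchHomTubeIso
open Summit.AtomisticToContinuum.Crystallization.Theorems.FrustratedLawDichotomyStrainedPatchPhaseCut
open Summit.AtomisticToContinuum.Crystallization.Theorems.FrustratedLawDichotomyStrainedPatchCoreTube
open Summit.AtomisticToContinuum.Crystallization.Theorems.FrustratedLawDichotomyStrainedPatchCoreTubeRecord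
open Summit.AtomisticToContinuum.Crystallization.Theorems.FrustratedLawDichotomyStrainedPatchCoreTubeMilli
open Summit.AtomisticToContinuum.Crystallization.Theorems.FrustratedLawDichotomyStrainedPatchStrainBands
open Summit.AtomisticToContinuum.Crystallization.Theorems.FrustratedLawDichotomyStrainedPatchChartFamilies
open Summit.AtomisticToContinuum.Crystallization.Theorems.FrustratedLawDichotomyStrainedPatchChartFamiliesBent
open Summit.AtomisticToContinuum.Crystallization.Theorems.FrustratedLawDichotomyStrainedPatchChartFamiliesPinned
open Summit.AtomisticToContinuum.Crystallization.Theorems.FrustratedLawDichotomyStrainedPatchEnvelopeLaw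
open Summit.AtomisticToContinuum.Crystallization.Theorems.FrustratedLawDichotomyStrainedPatchEnvelopeTaylor
open Literature.Barriers.AtomisticToContinuum.FlatleyTheil2015 (fccVec)

/-! ## §1. Presentations, the recut pair relation, the footprint -/

/-- The point set of a homogeneous `R`-ball about `x₀` on branch `φ` (`true` = fcc lattice through `G`; `false` = hcp: hexagonal family ∪ its translate by
`G (hcpShift + ξ)`) — the two alternatives of `IsHomBall`, selected by the branch label. -/
def homRange (φ : Bool) (G : E3 →L[ℝ] E3) (ξ : E3) (R : ℝ) (x₀ : E3) : Set E3 :=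
  cond φ {x | dist x x₀ ≤ R ∧ ∃ a : Fin 3 → ℤ, x = x₀ + latPt G fccVec a}
    {x | dist x x₀ ≤ R ∧ ∃ a : Fin 3 → ℤ, x = x₀ + latPt G hexFrame a ∨ x = x₀ + latPt G hexFrame a + G (hcpShift + ξ)}

/-- The (unbounded) vector set of the branch-`φ` lattice through `G` with hcp offset `ξ`, relative to a site at the origin (`homRange φ G ξ R x₀ = x₀ +` its
`R`-window). -/
def latSet (φ : Bool) (G : E3 →L[ℝ] E3) (ξ : E3) : Set E3 :=
  cond φ {v | ∃ a : Fin 3 → ℤ, v = latPt G fccVec a} {v | ∃ a : Fin 3 → ℤ, v = latPt G hexFrame a ∨ v = latPt G hexFrame a + G (hcpShift + ξ)}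

/-- The homogeneous ball is the `R`-window of the lattice vector set, translated to the centre. [formal bookkeeping] -/
theorem mem_homRange_iff {φ : Bool} {G : E3 →L[ℝ] E3} {ξ : E3} {R : ℝ} {x₀ x : E3} :
    x ∈ homRange φ G ξ R x₀ ↔ dist x x₀ ≤ R ∧ x - x₀ ∈ latSet φ G ξ := by
  cases φ <;> simp only [homRange, latSet, cond_true, cond_false, Set.mem_setOf_eq, sub_eq_iff_eq_add', add_assoc]

/-- **`WindowSep φ b G ξ R s`** — the `b`-bent branch-`φ` lattice is `s`-SEPARATED ON THE `R`-WINDOW: distinct lattice vectors whose bent images have norm `≤ R`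
have bent images at distance `≥ s`.  (The recut of (RFᴿ) re-cuts a window slightly LARGER than the chart's `133/10`-ball — by the factor `‖(1+A)⁻¹‖ ≤ 150/149` —
so the separation of the ENTERING sites must come from the presentation, not from the chart's own sites: this clause, at `R = 27/2`.) -/
def WindowSep (φ : Bool) (b : E3 → E3) (G : E3 →L[ℝ] E3) (ξ : E3) (R s : ℝ) : Prop :=
  ∀ v ∈ latSet φ G ξ, ∀ v' ∈ latSet φ G ξ, v ≠ v' → ‖b v‖ ≤ R → ‖b v'‖ ≤ R → s ≤ dist (b v) (b v')

/-- **`PresentedBy φ b G ξ R z₁ c₁`** — the instance is the `b`-bent image of the homogeneous `R`-ball of branch `φ`, matrix `G` (`‖G − 1‖ ≤ 1/4`) and hcp offset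
`ξ` (`‖ξ‖ ≤ 1/4`): `IsBentBall`/`IsHomBall` with the presentation `(φ, b, G, ξ)` exposed. -/
def PresentedBy (φ : Bool) (b : E3 → E3) (G : E3 →L[ℝ] E3) (ξ : E3) (R : ℝ) {M : ℕ} (z₁ : Fin M → E3) (c₁ : Fin M) : Prop :=
  ‖G - 1‖ ≤ 1 / 4 ∧ ‖ξ‖ ≤ 1 / 4 ∧ ∃ z₀ : Fin M → E3, Set.range z₀ = homRange φ G ξ R (z₀ c₁) ∧ ∀ a, z₁ a - z₁ c₁ = b (z₀ a - z₀ c₁)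

/-- A presented instance is a bent ball. [formal bookkeeping] -/
theorem isBentBall_of_presentedBy {𝓑 : Set (E3 → E3)} {φ : Bool} {b : E3 → E3} {G : E3 →L[ℝ] E3} {ξ : E3} {R : ℝ} {M : ℕ} {z₁ : Fin M → E3}
    {c₁ : Fin M} (hb : b ∈ 𝓑) (h : PresentedBy φ b G ξ R z₁ c₁) : IsBentBall 𝓑 R z₁ c₁ := by
  obtain ⟨hG, hξ, z₀, hr, hab⟩ := h
  refine ⟨b, z₀, hb, ⟨G, ξ, hG, hξ, ?_⟩, hab⟩
  cases φ
  · exact Or.inr (by simpa only [homRange, cond_false] using hr)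
  · exact Or.inl (by simpa only [homRange, cond_true] using hr)

/-- Every bent ball is presented. [formal bookkeeping] -/
theorem exists_presentedBy_of_isBentBall {𝓑 : Set (E3 → E3)} {R : ℝ} {M : ℕ} {z₁ : Fin M → E3} {c₁ : Fin M} (h : IsBentBall 𝓑 R z₁ c₁) :
    ∃ (φ : Bool) (b : E3 → E3) (G : E3 →L[ℝ] E3) (ξ : E3), b ∈ 𝓑 ∧ PresentedBy φ b G ξ R z₁ c₁ := by
  obtain ⟨b, z₀, hb, ⟨G, ξ, hG, hξ, hr⟩, hab⟩ := h
  rcases hr with hr | hr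
  · exact ⟨true, b, G, ξ, hb, hG, hξ, z₀, by simpa only [homRange, cond_true] using hr, hab⟩
  · exact ⟨false, b, G, ξ, hb, hG, hξ, z₀, by simpa only [homRange, cond_false] using hr, hab⟩

/-- ★ **`RecutNear 𝓑₀ κL t z₀ c₀ z₁ c₁`** [THE PAIR RELATION OF RECORD] — `z₁` is a `κL·t`-RECUT of `z₀`: for a presentation `(φ, b₀, G, ξ)` of `z₀` with
`b₀ ∈ 𝓑₀` there is a linear `A`, `‖A‖ ≤ κL·max(t,0)`, such that `z₁` is presented by `(φ, b₁, (1+A)·G, ξ)` on the SAME branch with the SAME offset and the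
CONJUGATE bend `b₁ ∘ (1+A) = (1+A) ∘ b₀`. -/
def RecutNear (𝓑₀ : Set (E3 → E3)) (κL t : ℝ) {M₀ : ℕ} (z₀ : Fin M₀ → E3) (c₀ : Fin M₀) {M₁ : ℕ} (z₁ : Fin M₁ → E3) (c₁ : Fin M₁) : Prop :=
  ∃ (φ : Bool) (b₀ b₁ : E3 → E3) (G : E3 →L[ℝ] E3) (ξ : E3) (A : E3 →L[ℝ] E3), b₀ ∈ 𝓑₀ ∧ PresentedBy φ b₀ G ξ (133 / 10) z₀ c₀ ∧
    ‖A‖ ≤ κL * max t 0 ∧ (∀ v, b₁ ((1 + A) v) = (1 + A) (b₀ v)) ∧ PresentedBy φ b₁ ((1 + A) * G) ξ (133 / 10) z₁ c₁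

/-- `RecutNear` is monotone in the constant. [formal bookkeeping] -/
theorem RecutNear.mono {𝓑₀ : Set (E3 → E3)} {κL κL' t : ℝ} {M₀ : ℕ} {z₀ : Fin M₀ → E3} {c₀ : Fin M₀} {M₁ : ℕ} {z₁ : Fin M₁ → E3} {c₁ : Fin M₁}
    (h : RecutNear 𝓑₀ κL t z₀ c₀ z₁ c₁) (hle : κL ≤ κL') : RecutNear 𝓑₀ κL' t z₀ c₀ z₁ c₁ := by
  obtain ⟨φ, b₀, b₁, G, ξ, A, hb, h₀, hA, hconj, h₁⟩ := h
  exact ⟨φ, b₀, b₁, G, ξ, A, hb, h₀, hA.trans (mul_le_mul_of_nonneg_right hle (le_max_right _ _)), hconj, h₁⟩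

/-- `RecutNear` is monotone in the bending class. [formal bookkeeping] -/
theorem RecutNear.mono_bends {𝓑₀ 𝓑₀' : Set (E3 → E3)} (hB : 𝓑₀ ⊆ 𝓑₀') {κL t : ℝ} {M₀ : ℕ} {z₀ : Fin M₀ → E3} {c₀ : Fin M₀} {M₁ : ℕ}
    {z₁ : Fin M₁ → E3} {c₁ : Fin M₁} (h : RecutNear 𝓑₀ κL t z₀ c₀ z₁ c₁) : RecutNear 𝓑₀' κL t z₀ c₀ z₁ c₁ := by
  obtain ⟨φ, b₀, b₁, G, ξ, A, hb, h₀, hA, hconj, h₁⟩ := h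
  exact ⟨φ, b₀, b₁, G, ξ, A, hB hb, h₀, hA, hconj, h₁⟩

/-- ★ STEP 0 (footprint, matrices): the two instances of a recut pair are presented on the same branch with the same offset and matrices within `(5/4)·κL·t`
(`‖(1+A)G − G‖ = ‖A·G‖ ≤ ‖A‖·‖G‖`, `‖G‖ ≤ 5/4`). [formal bookkeeping] -/
theorem RecutNear.footprint {𝓑₀ : Set (E3 → E3)} {κL t : ℝ} {M₀ : ℕ} {z₀ : Fin M₀ → E3} {c₀ : Fin M₀} {M₁ : ℕ} {z₁ : Fin M₁ → E3} {c₁ : Fin M₁}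
    (h : RecutNear 𝓑₀ κL t z₀ c₀ z₁ c₁) : ∃ (φ : Bool) (b₀ b₁ : E3 → E3) (G G₁ : E3 →L[ℝ] E3) (ξ : E3),
      b₀ ∈ 𝓑₀ ∧ PresentedBy φ b₀ G ξ (133 / 10) z₀ c₀ ∧ PresentedBy φ b₁ G₁ ξ (133 / 10) z₁ c₁ ∧ ‖G₁ - G‖ ≤ 5 / 4 * (κL * max t 0) := by
  obtain ⟨φ, b₀, b₁, G, ξ, A, hb, h₀, hA, -, h₁⟩ := h
  refine ⟨φ, b₀, b₁, G, (1 + A) * G, ξ, hb, h₀, h₁, ?_⟩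
  have hG : ‖G‖ ≤ 5 / 4 := by
    calc ‖G‖ = ‖(G - 1) + 1‖ := by rw [sub_add_cancel]
      _ ≤ ‖G - 1‖ + ‖(1 : E3 →L[ℝ] E3)‖ := norm_add_le _ _
      _ ≤ 1 / 4 + 1 := add_le_add h₀.1 (by rw [ContinuousLinearMap.one_def]; exact ContinuousLinearMap.norm_id_le)
      _ = 5 / 4 := by norm_num
  have hA0 : 0 ≤ κL * max t 0 := (norm_nonneg _).trans hA
  calc ‖(1 + A) * G - G‖ = ‖A * G‖ := by rw [add_mul, one_mul, add_sub_cancel_left]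
    _ ≤ ‖A‖ * ‖G‖ := norm_mul_le _ _
    _ ≤ κL * max t 0 * (5 / 4) := mul_le_mul hA hG (norm_nonneg _) hA0
    _ = 5 / 4 * (κL * max t 0) := by ring

/-- ★ STEP 0 (footprint, deviation fields): along a site labelled in both instances with `z₁ (e₁ a) − z₁ c₁ = (1+A)(z₀ (e₀ a) − z₀ c₀)` the comparison chart's
deviation is the chart's minus the linear correction: `dev₁ = dev₀ − A·w⁰`. [formal bookkeeping] -/
theorem dev_recut {M : ℕ} (z : Fin M → E3) (c : Fin M) {M₀ : ℕ} (z₀ : Fin M₀ → E3) (c₀ : Fin M₀) (e₀ : Fin M → Fin M₀) {M₁ : ℕ} (z₁ : Fin M₁ → E3)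
    (c₁ : Fin M₁) (e₁ : Fin M → Fin M₁) (A : E3 →L[ℝ] E3) {a : Fin M} (h : z₁ (e₁ a) - z₁ c₁ = (1 + A) (z₀ (e₀ a) - z₀ c₀)) :
    dev z c z₁ c₁ e₁ a = dev z c z₀ c₀ e₀ a - A (z₀ (e₀ a) - z₀ c₀) := by
  simp only [dev, h, add_apply, one_apply_eq_self]
  abel

/-! ## §2. Level 2 on recut pairs: (BASᴿ), (MEMᴿ), (LINᴿ), (ENVᴿ) and the seam with the UNPAIRED (T2) -/

/-- **`PairedChart 𝓘₀ 𝓘₁ 𝓑₀ τ₀ τ₁ κL t z c z₀ c₀ e₀ z₁ c₁ e₁`** — the cluster is charted (coarse `τ₀`, fine `t`) by the chart instance `z₀ ∈ 𝓘₀` and COARSELY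
(`τ₁`; fine = coarse: no fine clause) by the comparison `z₁ ∈ 𝓘₁`, a `κL·t`-recut of `z₀`. -/
def PairedChart (𝓘₀ 𝓘₁ : (M₀ : ℕ) → (Fin M₀ → E3) → Fin M₀ → Prop) (𝓑₀ : Set (E3 → E3)) (τ₀ τ₁ κL t : ℝ) {M : ℕ} (z : Fin M → E3) (c : Fin M)
    {M₀ : ℕ} (z₀ : Fin M₀ → E3) (c₀ : Fin M₀) (e₀ : Fin M → Fin M₀) {M₁ : ℕ} (z₁ : Fin M₁ → E3) (c₁ : Fin M₁) (e₁ : Fin M → Fin M₁) : Prop :=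
  ChartBy 𝓘₀ τ₀ t z c z₀ c₀ e₀ ∧ RecutNear 𝓑₀ κL t z₀ c₀ z₁ c₁ ∧ ChartBy 𝓘₁ τ₁ τ₁ z c z₁ c₁ e₁

/-- **(ENVᴿ_P) `PairedEnvelopeOn P 𝓘₀ 𝓘₁ 𝓑₀ τ₀ τ₁ κL T Ψ`** [ANALYTIC; decomposed below] — for an admissible clean mono-phase cluster with a paired chart
(`0 ≤ t ≤ T(z₀)`) and chart predicate `P … t` on the comparison: `S(z₁) − Ψ(z₁)(t) ≤ S(z)`. -/
def PairedEnvelopeOn (P : (M : ℕ) → (Fin M → E3) → Fin M → (M₁ : ℕ) → (Fin M₁ → E3) → Fin M₁ → (Fin M → Fin M₁) → ℝ → Prop)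
    (𝓘₀ 𝓘₁ : (M₀ : ℕ) → (Fin M₀ → E3) → Fin M₀ → Prop) (𝓑₀ : Set (E3 → E3)) (τ₀ τ₁ κL : ℝ) (T : (M₀ : ℕ) → (Fin M₀ → E3) → Fin M₀ → ℝ)
    (Ψ : (M₁ : ℕ) → (Fin M₁ → E3) → Fin M₁ → ℝ → ℝ) : Prop :=
  ∀ (M : ℕ) (z : Fin M → E3) (c : Fin M) (M₀ : ℕ) (z₀ : Fin M₀ → E3) (c₀ : Fin M₀) (e₀ : Fin M → Fin M₀) (M₁ : ℕ) (z₁ : Fin M₁ → E3) (c₁ : Fin M₁)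
    (e₁ : Fin M → Fin M₁) (t : ℝ), Admissible M z c → CleanBall (63 / 10) z c → MonoPhaseBall (63 / 10) z c → 0 ≤ t → t ≤ T M₀ z₀ c₀ →
      PairedChart 𝓘₀ 𝓘₁ 𝓑₀ τ₀ τ₁ κL t z c z₀ c₀ e₀ z₁ c₁ e₁ → P M z c M₁ z₁ c₁ e₁ t →
        ballAvg (9 / 5) z₁ (xRec M₁ z₁) c₁ - Ψ M₁ z₁ c₁ t ≤ ballAvg (9 / 5) z (xRec M z) c

/-- **(BASᴿ) `PairedBasin P 𝓘₀ 𝓘₁ 𝓑₀ τ₀ τ₁ κL T δ`** [ANALYTIC — quantitative IFT · UNDECIDED · INSTRUMENTABLE] — an admissible clean mono-phase cluster with a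
paired chart and chart predicate `P … t` (`0 ≤ t ≤ T(z₀)`) is `δ`-finely charted by the comparison.  (No `κA`: the fine data are `P`'s.) -/
def PairedBasin (P : (M : ℕ) → (Fin M → E3) → Fin M → (M₁ : ℕ) → (Fin M₁ → E3) → Fin M₁ → (Fin M → Fin M₁) → ℝ → Prop)
    (𝓘₀ 𝓘₁ : (M₀ : ℕ) → (Fin M₀ → E3) → Fin M₀ → Prop) (𝓑₀ : Set (E3 → E3)) (τ₀ τ₁ κL : ℝ) (T : (M₀ : ℕ) → (Fin M₀ → E3) → Fin M₀ → ℝ) (δ : ℝ) :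
    Prop :=
  ∀ (M : ℕ) (z : Fin M → E3) (c : Fin M) (M₀ : ℕ) (z₀ : Fin M₀ → E3) (c₀ : Fin M₀) (e₀ : Fin M → Fin M₀) (M₁ : ℕ) (z₁ : Fin M₁ → E3) (c₁ : Fin M₁)
    (e₁ : Fin M → Fin M₁) (t : ℝ), Admissible M z c → CleanBall (63 / 10) z c → MonoPhaseBall (63 / 10) z c → 0 ≤ t → t ≤ T M₀ z₀ c₀ →
      PairedChart 𝓘₀ 𝓘₁ 𝓑₀ τ₀ τ₁ κL t z c z₀ c₀ e₀ z₁ c₁ e₁ → P M z c M₁ z₁ c₁ e₁ t → FineChart δ z c z₁ c₁ e₁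

/-- **(MEMᴿ) `PairedMembership 𝓘₀ 𝓘₁ 𝓑₀ τ₀ τ₁ κL T δ μ`** [COMBINATORIAL + TABLE · INSTRUMENTABLE on (chart box) × (recut ball)] — for an admissible clean
cluster with a paired chart, `δ`-finely charted by the comparison: `frozenAvg − μ(z₁) ≤ S(z)`. -/
def PairedMembership (𝓘₀ 𝓘₁ : (M₀ : ℕ) → (Fin M₀ → E3) → Fin M₀ → Prop) (𝓑₀ : Set (E3 → E3)) (τ₀ τ₁ κL : ℝ)
    (T : (M₀ : ℕ) → (Fin M₀ → E3) → Fin M₀ → ℝ) (δ : ℝ) (μ : (M₁ : ℕ) → (Fin M₁ → E3) → Fin M₁ → ℝ) : Prop :=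
  ∀ (M : ℕ) (z : Fin M → E3) (c : Fin M) (M₀ : ℕ) (z₀ : Fin M₀ → E3) (c₀ : Fin M₀) (e₀ : Fin M → Fin M₀) (M₁ : ℕ) (z₁ : Fin M₁ → E3) (c₁ : Fin M₁)
    (e₁ : Fin M → Fin M₁) (t : ℝ), Admissible M z c → CleanBall (63 / 10) z c → 0 ≤ t → t ≤ T M₀ z₀ c₀ →
      PairedChart 𝓘₀ 𝓘₁ 𝓑₀ τ₀ τ₁ κL t z c z₀ c₀ e₀ z₁ c₁ e₁ → FineChart δ z c z₁ c₁ e₁ →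
        frozenAvg z c z₁ c₁ e₁ - μ M₁ z₁ c₁ ≤ ballAvg (9 / 5) z (xRec M z) c

/-- **(LINᴿ) `PairedSlaved P 𝓘₀ 𝓘₁ 𝓑₀ τ₀ τ₁ κL T δ G w Ψ`** [MECHANICS — the slaving estimate · UNDECIDED · INSTRUMENTABLE] — for an admissible clean
mono-phase cluster with a paired chart, chart predicate `P … t`, `δ`-finely charted by the comparison: `−Ψ(z₁)(t) ≤ lin_G(dev) − quad_w(dev)`. -/
def PairedSlaved (P : (M : ℕ) → (Fin M → E3) → Fin M → (M₁ : ℕ) → (Fin M₁ → E3) → Fin M₁ → (Fin M → Fin M₁) → ℝ → Prop)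
    (𝓘₀ 𝓘₁ : (M₀ : ℕ) → (Fin M₀ → E3) → Fin M₀ → Prop) (𝓑₀ : Set (E3 → E3)) (τ₀ τ₁ κL : ℝ) (T : (M₀ : ℕ) → (Fin M₀ → E3) → Fin M₀ → ℝ) (δ : ℝ)
    (G : (M₁ : ℕ) → (Fin M₁ → E3) → Fin M₁ → Fin M₁ → (E3 →L[ℝ] ℝ)) (w : (M₁ : ℕ) → (Fin M₁ → E3) → Fin M₁ → Fin M₁ → Fin M₁ → ℝ)
    (Ψ : (M₁ : ℕ) → (Fin M₁ → E3) → Fin M₁ → ℝ → ℝ) : Prop :=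
  ∀ (M : ℕ) (z : Fin M → E3) (c : Fin M) (M₀ : ℕ) (z₀ : Fin M₀ → E3) (c₀ : Fin M₀) (e₀ : Fin M → Fin M₀) (M₁ : ℕ) (z₁ : Fin M₁ → E3) (c₁ : Fin M₁)
    (e₁ : Fin M → Fin M₁) (t : ℝ), Admissible M z c → CleanBall (63 / 10) z c → MonoPhaseBall (63 / 10) z c → 0 ≤ t → t ≤ T M₀ z₀ c₀ →
      PairedChart 𝓘₀ 𝓘₁ 𝓑₀ τ₀ τ₁ κL t z c z₀ c₀ e₀ z₁ c₁ e₁ → P M z c M₁ z₁ c₁ e₁ t → FineChart δ z c z₁ c₁ e₁ →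
        -Ψ M₁ z₁ c₁ t ≤ linTerm G z c z₁ c₁ e₁ - quadTerm w z c z₁ c₁ e₁

/-- ★★ THE PAIRED LEVEL-2 SEAM: (BASᴿ) ∧ (T2 on `𝓘₁`, UNPAIRED, any fine parameter) ∧ (MEMᴿ) ∧ (LINᴿ) ⟹ (ENVᴿ_P) with modulus `Ψ + ϱ + μ`. [folklore] -/
theorem pairedEnvelopeOn_of_taylor {P : (M : ℕ) → (Fin M → E3) → Fin M → (M₁ : ℕ) → (Fin M₁ → E3) → Fin M₁ → (Fin M → Fin M₁) → ℝ → Prop}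
    {𝓘₀ 𝓘₁ : (M₀ : ℕ) → (Fin M₀ → E3) → Fin M₀ → Prop} {𝓑₀ : Set (E3 → E3)} {τ₀ τ₁ κL δ : ℝ} {T : (M₀ : ℕ) → (Fin M₀ → E3) → Fin M₀ → ℝ}
    {G : (M₁ : ℕ) → (Fin M₁ → E3) → Fin M₁ → Fin M₁ → (E3 →L[ℝ] ℝ)} {w : (M₁ : ℕ) → (Fin M₁ → E3) → Fin M₁ → Fin M₁ → Fin M₁ → ℝ}
    {ϱ μ : (M₁ : ℕ) → (Fin M₁ → E3) → Fin M₁ → ℝ} {Ψ : (M₁ : ℕ) → (Fin M₁ → E3) → Fin M₁ → ℝ → ℝ} (hB : PairedBasin P 𝓘₀ 𝓘₁ 𝓑₀ τ₀ τ₁ κL T δ)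
    (hT : SmoothTaylorTwo 𝓘₁ τ₁ δ G w ϱ) (hM : PairedMembership 𝓘₀ 𝓘₁ 𝓑₀ τ₀ τ₁ κL T δ μ) (hL : PairedSlaved P 𝓘₀ 𝓘₁ 𝓑₀ τ₀ τ₁ κL T δ G w Ψ) :
    PairedEnvelopeOn P 𝓘₀ 𝓘₁ 𝓑₀ τ₀ τ₁ κL T (fun M₁ z₁ c₁ t => Ψ M₁ z₁ c₁ t + ϱ M₁ z₁ c₁ + μ M₁ z₁ c₁) := by
  intro M z c M₀ z₀ c₀ e₀ M₁ z₁ c₁ e₁ t hz hcl hm ht htT hpc hP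
  have hf := hB M z c M₀ z₀ c₀ e₀ M₁ z₁ c₁ e₁ t hz hcl hm ht htT hpc hP
  have h₁ := hT M z c M₁ z₁ c₁ e₁ τ₁ hz hpc.2.2 hf
  have h₂ := hM M z c M₀ z₀ c₀ e₀ M₁ z₁ c₁ e₁ t hz hcl ht htT hpc hf
  have h₃ := hL M z c M₀ z₀ c₀ e₀ M₁ z₁ c₁ e₁ t hz hcl hm ht htT hpc hP hf
  show _ - (Ψ M₁ z₁ c₁ t + ϱ M₁ z₁ c₁ + μ M₁ z₁ c₁) ≤ _
  linarith

/-- THE TRADE on (MEM): the unpaired g53 statement (any fine parameter) ⟹ (MEMᴿ) for every chart family, bending class, constants, law. [formal bookkeeping] -/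
theorem pairedMembership_of_membershipColumn {𝓘₀ 𝓘₁ : (M₀ : ℕ) → (Fin M₀ → E3) → Fin M₀ → Prop} {𝓑₀ : Set (E3 → E3)} {τ₀ τ₁ κL δ : ℝ}
    {T : (M₀ : ℕ) → (Fin M₀ → E3) → Fin M₀ → ℝ} {μ : (M₁ : ℕ) → (Fin M₁ → E3) → Fin M₁ → ℝ} (h : MembershipColumn 𝓘₁ τ₁ δ μ) :
    PairedMembership 𝓘₀ 𝓘₁ 𝓑₀ τ₀ τ₁ κL T δ μ :=
  fun M z c _ _ _ _ M₁ z₁ c₁ e₁ _ hz hcl _ _ hpc hf => h M z c M₁ z₁ c₁ e₁ τ₁ hz hcl hpc.2.2 hf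

/-! ## §3. Level 1 on recut pairs: (RFᴿ), (DOMᴿ), (F1ᴿ-cap) and the seam; level 0: (F3ᴿ) and the seam to `EdgeFarFloor` / [CORE-FAR] -/

/-- **(RFᴿ) `AffineRecut 𝓘₀ 𝓘₁ 𝓑₀ τ₀ τ₁ κN κL T`** [KINEMATIC] — every admissible clean mono-phase cluster charted (coarse `τ₀`, fine `t ≤ T(z₀)`) by an
instance of `𝓘₀` is COARSELY (`τ₁`) charted by a `κL·t`-RECUT of it lying in `𝓘₁`, `κN·t`-level-near, with projected affine-free deviation of sup `t` on the
uncapped annulus.  (No fine clause on the comparison chart: `κA` eliminated.) -/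
def AffineRecut (𝓘₀ 𝓘₁ : (M₀ : ℕ) → (Fin M₀ → E3) → Fin M₀ → Prop) (𝓑₀ : Set (E3 → E3)) (τ₀ τ₁ κN κL : ℝ)
    (T : (M₀ : ℕ) → (Fin M₀ → E3) → Fin M₀ → ℝ) : Prop :=
  ∀ (M : ℕ) (z : Fin M → E3) (c : Fin M) (M₀ : ℕ) (z₀ : Fin M₀ → E3) (c₀ : Fin M₀) (e₀ : Fin M → Fin M₀) (t : ℝ),
    Admissible M z c → CleanBall (63 / 10) z c → MonoPhaseBall (63 / 10) z c → 0 ≤ t → t ≤ T M₀ z₀ c₀ → ChartBy 𝓘₀ τ₀ t z c z₀ c₀ e₀ →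
      ∃ (M₁ : ℕ) (z₁ : Fin M₁ → E3) (c₁ : Fin M₁) (e₁ : Fin M → Fin M₁),
        LevelNear κN t z₀ c₀ z₁ c₁ ∧ RecutNear 𝓑₀ κL t z₀ c₀ z₁ c₁ ∧ ChartBy 𝓘₁ τ₁ τ₁ z c z₁ c₁ e₁ ∧ projectedFree M z c M₁ z₁ c₁ e₁ t

/-- **(DOMᴿ) `RecutDomination 𝓘₀ 𝓘₁ 𝓑₀ κN κL T Ψ Φ`** [TABLE CERTIFICATE over RECUT pairs · INSTRUMENTABLE on (chart box) × (‖A‖ ≤ κL·T)] —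
`Ψ(z₁)(t) ≤ Φ(z₀)(t)` whenever `z₀ ∈ 𝓘₀`, `z₁ ∈ 𝓘₁`, `0 ≤ t ≤ T(z₀)`, the pair is `κN·t`-level-near AND a `κL·t`-recut. -/
def RecutDomination (𝓘₀ 𝓘₁ : (M₀ : ℕ) → (Fin M₀ → E3) → Fin M₀ → Prop) (𝓑₀ : Set (E3 → E3)) (κN κL : ℝ) (T : (M₀ : ℕ) → (Fin M₀ → E3) → Fin M₀ → ℝ)
    (Ψ Φ : (M₀ : ℕ) → (Fin M₀ → E3) → Fin M₀ → ℝ → ℝ) : Prop :=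
  ∀ (M₀ : ℕ) (z₀ : Fin M₀ → E3) (c₀ : Fin M₀) (M₁ : ℕ) (z₁ : Fin M₁ → E3) (c₁ : Fin M₁) (t : ℝ), 𝓘₀ M₀ z₀ c₀ → 𝓘₁ M₁ z₁ c₁ →
    0 ≤ t → t ≤ T M₀ z₀ c₀ → LevelNear κN t z₀ c₀ z₁ c₁ → RecutNear 𝓑₀ κL t z₀ c₀ z₁ c₁ → Ψ M₁ z₁ c₁ t ≤ Φ M₀ z₀ c₀ t

/-- THE TRADE on (DOM): level-near domination ⟹ recut domination, on any smaller chart family. [formal bookkeeping] -/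
theorem recutDomination_of_refitDomination {𝓘₀ 𝓘₀' 𝓘₁ : (M₀ : ℕ) → (Fin M₀ → E3) → Fin M₀ → Prop} {𝓑₀ : Set (E3 → E3)} {κN κL : ℝ}
    {T : (M₀ : ℕ) → (Fin M₀ → E3) → Fin M₀ → ℝ} {Ψ Φ : (M₀ : ℕ) → (Fin M₀ → E3) → Fin M₀ → ℝ → ℝ} (h : RefitDomination 𝓘₀' 𝓘₁ κN T Ψ Φ)
    (hle : FamilyLE 𝓘₀ 𝓘₀') : RecutDomination 𝓘₀ 𝓘₁ 𝓑₀ κN κL T Ψ Φ :=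
  fun M₀ z₀ c₀ M₁ z₁ c₁ t hI₀ hI₁ ht htT hN _ => h M₀ z₀ c₀ M₁ z₁ c₁ t (hle M₀ z₀ c₀ hI₀) hI₁ ht htT hN

/-- **(F1ᴿ-cap) `FamilyEnvelopeRecutCap 𝓘₀ 𝓘₁ 𝓑₀ τ₀ κN κL Φ T`** [ANALYTIC] — (F1ʳ-cap) with the comparison instance a level-near RECUT of the chart. -/
def FamilyEnvelopeRecutCap (𝓘₀ 𝓘₁ : (M₀ : ℕ) → (Fin M₀ → E3) → Fin M₀ → Prop) (𝓑₀ : Set (E3 → E3)) (τ₀ κN κL : ℝ)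
    (Φ : (M₀ : ℕ) → (Fin M₀ → E3) → Fin M₀ → ℝ → ℝ) (T : (M₀ : ℕ) → (Fin M₀ → E3) → Fin M₀ → ℝ) : Prop :=
  ∀ (M : ℕ) (z : Fin M → E3) (c : Fin M) (M₀ : ℕ) (z₀ : Fin M₀ → E3) (c₀ : Fin M₀) (e₀ : Fin M → Fin M₀) (t : ℝ),
    Admissible M z c → CleanBall (63 / 10) z c → MonoPhaseBall (63 / 10) z c → 0 ≤ t → t ≤ T M₀ z₀ c₀ → ChartBy 𝓘₀ τ₀ t z c z₀ c₀ e₀ →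
      ∃ (M₁ : ℕ) (z₁ : Fin M₁ → E3) (c₁ : Fin M₁), 𝓘₁ M₁ z₁ c₁ ∧ LevelNear κN t z₀ c₀ z₁ c₁ ∧ RecutNear 𝓑₀ κL t z₀ c₀ z₁ c₁ ∧
        ballAvg (9 / 5) z₁ (xRec M₁ z₁) c₁ - Φ M₀ z₀ c₀ t ≤ ballAvg (9 / 5) z (xRec M z) c

/-- (F1ᴿ-cap) ⟹ (F1ʳ-cap) (forget the recut relation). [formal bookkeeping] -/
theorem familyEnvelopeRefitCap_of_recutCap {𝓘₀ 𝓘₁ : (M₀ : ℕ) → (Fin M₀ → E3) → Fin M₀ → Prop} {𝓑₀ : Set (E3 → E3)} {τ₀ κN κL : ℝ}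
    {Φ : (M₀ : ℕ) → (Fin M₀ → E3) → Fin M₀ → ℝ → ℝ} {T : (M₀ : ℕ) → (Fin M₀ → E3) → Fin M₀ → ℝ} (h : FamilyEnvelopeRecutCap 𝓘₀ 𝓘₁ 𝓑₀ τ₀ κN κL Φ T) :
    FamilyEnvelopeRefitCap 𝓘₀ 𝓘₁ τ₀ κN Φ T := by
  intro M z c M₀ z₀ c₀ e₀ t hz hcl hm ht htT hch
  obtain ⟨M₁, z₁, c₁, hI₁, hN, -, h₁⟩ := h M z c M₀ z₀ c₀ e₀ t hz hcl hm ht htT hch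
  exact ⟨M₁, z₁, c₁, hI₁, hN, h₁⟩

/-- ★★ THE PAIRED LEVEL-1 SEAM: (RFᴿ) ∧ (ENVᴿ_projectedFree) ∧ (DOMᴿ) ⟹ (F1ᴿ-cap).  No law hypothesis (the chart is in scope at level 2).  One `linarith`.
[folklore] -/
theorem familyEnvelopeRecutCap_of_pieces {𝓘₀ 𝓘₁ : (M₀ : ℕ) → (Fin M₀ → E3) → Fin M₀ → Prop} {𝓑₀ : Set (E3 → E3)} {τ₀ τ₁ κN κL : ℝ}
    {T : (M₀ : ℕ) → (Fin M₀ → E3) → Fin M₀ → ℝ} {Ψ Φ : (M₀ : ℕ) → (Fin M₀ → E3) → Fin M₀ → ℝ → ℝ} (hRF : AffineRecut 𝓘₀ 𝓘₁ 𝓑₀ τ₀ τ₁ κN κL T)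
    (hE : PairedEnvelopeOn projectedFree 𝓘₀ 𝓘₁ 𝓑₀ τ₀ τ₁ κL T Ψ) (hD : RecutDomination 𝓘₀ 𝓘₁ 𝓑₀ κN κL T Ψ Φ) :
    FamilyEnvelopeRecutCap 𝓘₀ 𝓘₁ 𝓑₀ τ₀ κN κL Φ T := by
  intro M z c M₀ z₀ c₀ e₀ t hz hcl hm ht htT hch
  obtain ⟨M₁, z₁, c₁, e₁, hN, hRN, hch₁, hP⟩ := hRF M z c M₀ z₀ c₀ e₀ t hz hcl hm ht htT hch
  have h₁ := hE M z c M₀ z₀ c₀ e₀ M₁ z₁ c₁ e₁ t hz hcl hm ht htT ⟨hch, hRN, hch₁⟩ hP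
  have h₂ := hD M₀ z₀ c₀ M₁ z₁ c₁ t hch.1 hch₁.1 ht htT hN hRN
  exact ⟨M₁, z₁, c₁, hch₁.1, hN, hRN, by linarith⟩

/-- **(F3ᴿ) `FamilyCertRecut 𝓘₀ 𝓘₁ 𝓑₀ κN κL φ Φ T`** [TABLE CERTIFICATE over RECUT pairs · INSTRUMENTABLE on (chart box) × (‖A‖ ≤ κL·T)] —
`φ ≤ S(z₁) − Φ(z₀)(T(z₀))` whenever `z₀ ∈ 𝓘₀`, `z₁ ∈ 𝓘₁` are `κN·T(z₀)`-level-near AND `z₁` is a `κL·T(z₀)`-recut of `z₀`. -/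
def FamilyCertRecut (𝓘₀ 𝓘₁ : (M₀ : ℕ) → (Fin M₀ → E3) → Fin M₀ → Prop) (𝓑₀ : Set (E3 → E3)) (κN κL φ : ℝ)
    (Φ : (M₀ : ℕ) → (Fin M₀ → E3) → Fin M₀ → ℝ → ℝ) (T : (M₀ : ℕ) → (Fin M₀ → E3) → Fin M₀ → ℝ) : Prop :=
  ∀ (M₀ : ℕ) (z₀ : Fin M₀ → E3) (c₀ : Fin M₀) (M₁ : ℕ) (z₁ : Fin M₁ → E3) (c₁ : Fin M₁), 𝓘₀ M₀ z₀ c₀ → 𝓘₁ M₁ z₁ c₁ →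
    LevelNear κN (T M₀ z₀ c₀) z₀ c₀ z₁ c₁ → RecutNear 𝓑₀ κL (T M₀ z₀ c₀) z₀ c₀ z₁ c₁ →
      φ ≤ ballAvg (9 / 5) z₁ (xRec M₁ z₁) c₁ - Φ M₀ z₀ c₀ (T M₀ z₀ c₀)

/-- THE TRADE on (F3): the level-near certificate ⟹ the recut certificate, on any smaller chart family. [formal bookkeeping] -/
theorem familyCertRecut_of_certRefit {𝓘₀ 𝓘₀' 𝓘₁ : (M₀ : ℕ) → (Fin M₀ → E3) → Fin M₀ → Prop} {𝓑₀ : Set (E3 → E3)} {κN κL φ : ℝ}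
    {Φ : (M₀ : ℕ) → (Fin M₀ → E3) → Fin M₀ → ℝ → ℝ} {T : (M₀ : ℕ) → (Fin M₀ → E3) → Fin M₀ → ℝ} (h : FamilyCertRefit 𝓘₀' 𝓘₁ κN φ Φ T)
    (hle : FamilyLE 𝓘₀ 𝓘₀') : FamilyCertRecut 𝓘₀ 𝓘₁ 𝓑₀ κN κL φ Φ T :=
  fun M₀ z₀ c₀ M₁ z₁ c₁ hI₀ hI₁ hN _ => h M₀ z₀ c₀ M₁ z₁ c₁ (hle M₀ z₀ c₀ hI₀) hI₁ hN

/-- ★★ THE PAIRED LEVEL-0 SEAM: (F1ᴿ-cap) ∧ (F2 on the chart family) ∧ (F3ᴿ) ⟹ `EdgeFarFloor (63/10) (63/10) ρ ε η₂ φ` ((F2)'s chart of the rotated cluster at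
`t = T(z₀)`; (F1ᴿ-cap) hands a level-near recut; (F3ᴿ) prices it; the score is rotation invariant). [folklore] -/
theorem edgeFar_of_familyRecutCap {𝓘₀ 𝓘₁ : (M₀ : ℕ) → (Fin M₀ → E3) → Fin M₀ → Prop} {𝓑₀ : Set (E3 → E3)} {ρ ε η₂ τ₀ κN κL φ : ℝ}
    {Φ : (M₀ : ℕ) → (Fin M₀ → E3) → Fin M₀ → ℝ → ℝ} {T : (M₀ : ℕ) → (Fin M₀ → E3) → Fin M₀ → ℝ} (hE : FamilyEnvelopeRecutCap 𝓘₀ 𝓘₁ 𝓑₀ τ₀ κN κL Φ T)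
    (hR : FamilyRoom 𝓘₀ ρ ε η₂ τ₀ T) (hC : FamilyCertRecut 𝓘₀ 𝓘₁ 𝓑₀ κN κL φ Φ T) : EdgeFarFloor (63 / 10) (63 / 10) ρ ε η₂ φ := by
  intro M z c hz hcl hm hn hg
  obtain ⟨R, M₀, z₀, c₀, e, ht, hch⟩ := hR M z c hz hcl hm hn hg
  obtain ⟨M₁, z₁, c₁, hI₁, hN, hRN, h₁⟩ := hE M (⇑R ∘ z) c M₀ z₀ c₀ e _ ((admissible_comp_iff R z c).2 hz) ((cleanBall_comp_iff R z c).2 hcl)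
    ((monoPhaseBall_comp_iff R z c).2 hm) ht le_rfl hch
  rw [ballAvg_xRec_comp] at h₁
  have h₃ := hC M₀ z₀ c₀ M₁ z₁ c₁ hch.1 hI₁ hN hRN
  linarith

/-- ★★ THE PAIRED NODE TO [CORE-FAR]: (F1ᴿ-cap) ∧ (F2) ∧ (F3ᴿ) ∧ [BRIDGE] ∧ [SOFT-FAR] ⟹ `CoreOffTubeFloor (63/10) (63/10) ρ ε φ`. [folklore] -/
theorem coreOff_of_familyRecutCap_of_band_of_soft {𝓘₀ 𝓘₁ : (M₀ : ℕ) → (Fin M₀ → E3) → Fin M₀ → Prop} {𝓑₀ : Set (E3 → E3)} {ρ ε ηE η₂ τ₀ κN κL φ : ℝ}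
    {Φ : (M₀ : ℕ) → (Fin M₀ → E3) → Fin M₀ → ℝ → ℝ} {T : (M₀ : ℕ) → (Fin M₀ → E3) → Fin M₀ → ℝ} (hE : FamilyEnvelopeRecutCap 𝓘₀ 𝓘₁ 𝓑₀ τ₀ κN κL Φ T)
    (hR : FamilyRoom 𝓘₀ ρ ε ηE τ₀ T) (hC : FamilyCertRecut 𝓘₀ 𝓘₁ 𝓑₀ κN κL φ Φ T) (hB : BandFarFloor (63 / 10) (63 / 10) ρ ε ηE η₂ φ)
    (hS : SoftFarFloor (63 / 10) (63 / 10) ρ ε η₂ φ) : CoreOffTubeFloor (63 / 10) (63 / 10) ρ ε φ :=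
  coreOff_of_edge_of_band_of_soft (edgeFar_of_familyRecutCap hE hR hC) hB hS

/-! ## §4. The footprint hypothesis `InteriorChart` and the pins `β₀, ς₀, s₀, κL₀` (the pinned families and the record node: `…RecutRecord`) -/

/-- **`InteriorChart 𝓑₀ β ς s z₀ c₀`** [THE FOOTPRINT HYPOTHESIS, chart side] — the instance has a presentation `(φ, b, G, ξ)` with bend `b ∈ 𝓑₀`, matrix
`‖G − 1‖ ≤ β` (INTERIOR of the `1/4`-box), hcp offset `‖ξ‖ ≤ ς` (interior of the `1/4`-box; vacuous on the fcc branch), whose bent lattice is `s`-separated on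
the `27/2`-window (interior of `Sep (7/10)`, and covering the sites that ENTER under a recut): the slack (RFᴿ)'s recut spends (`(1+A)G` stays in the box, the
re-cut image stays `7/10`-separated) and the `ξ`-footprint of critic row 982 (b) (the recut inherits `ξ` from its chart: `ξ₁ = ξ₀`). -/
def InteriorChart (𝓑₀ : Set (E3 → E3)) (β ς s : ℝ) {M₀ : ℕ} (z₀ : Fin M₀ → E3) (c₀ : Fin M₀) : Prop :=
  ∃ (φ : Bool) (b : E3 → E3) (G : E3 →L[ℝ] E3) (ξ : E3), b ∈ 𝓑₀ ∧ PresentedBy φ b G ξ (133 / 10) z₀ c₀ ∧ ‖G - 1‖ ≤ β ∧ ‖ξ‖ ≤ ς ∧ WindowSep φ b G ξ (27 / 2) s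

/-- Pin: the interior matrix box of the chart family `β₀ = 9/50` (critic row 982 (b): `0.15`, or `0.18` if the recut algebra wants room; census FOOTPRINT27:
admissible chart centres have `‖G − 1‖ ≤ 0.1316`; slack to the `1/4`-box `0.07 ≫ (5/4)·κL₀·T₀ = 1/120`). -/
noncomputable def beta0 : ℝ := 9 / 50
/-- Pin: the hcp-offset box of the chart family `ς₀ = 1/10` (critic row 982 (b); census FOOTPRINT27: admissible hcp chart centres have `‖ξ‖ ≲ 0.038–0.053`). -/
noncomputable def xi0 : ℝ := 1 / 10
/-- Pin: the window separation of the chart family `s₀ = 3/4` (`(1 − 1/150)·3/4 ≥ 7/10`; census FOOTPRINT27: admissible chart centres have `d ∈ [0.877, 1.070]`). -/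
noncomputable def sep0 : ℝ := 3 / 4
/-- Pin: the recut constant `κL₀ = 2/5` (`≥` the measured least-squares constant `0.316`, `refit54.json`). -/
noncomputable def kL0 : ℝ := 2 / 5

end Summit.AtomisticToContinuum.Crystallization.Theorems.FrustratedLawDichotomyStrainedPatchRecutPairs
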